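import Summits.BirchSwinnertonDyer.BirchSwinnertonDyer.Theorems.AlignedTransportAtTwoMainConjectureOfRankZeroBSDAtTwoCyclotomicLayerRoadBinary
import HarnessLib

/-!
# Route `AlignedTransportAtTwo`, crux C2 `MainConjectureOfRankZeroBSDAtTwo` (stmt-BirchSwinnertonDyer-22298):
# THE `λ₂ = 5` AND `λ₂ = 7` ROWS OF THE `a₂ = −1` ROAD, CERTIFICATE-FREE — `λ₂ = 5`: Mordell–Weil growth above `ℚ(√2)` only in `ℚ₂/ℚ₁`, by exactly `2`
# (`rank W(ℚ_m) ∈ {r₁, r₁ + 2}`); `λ₂ = 7`: no growth above `ℚ₃`, and not in both `ℚ₂/ℚ₁` and `ℚ₃/ℚ₂`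

HONEST FRAMING (cell `bsd-f1-sign2`, WIDTH-5 attached prover seat `bsd-line-att-p5` gen 37 on line `birth` of the lead `bsd-line-att-p2`;
`--supports` stmt-BirchSwinnertonDyer-22298, closes nothing; BSD is NOT proved by any of this; the crux C2, its verdict «blocked-on
`Rank1Residual.GreenbergMuConjectureIrreducible`» and every registered stub are untouched). THEOREMS ONLY — no `def`, no `sorry`, nothing asserted about any
particular curve. PRINT binders `h17` [+ `hGZK`]. NO factorisation certificate: only `λ(G)`, `μ(G) = 0`, the road, `a₂ = −1`, unit symbol. Companion of
`…CyclotomicLayerRoadMinus{,Pairs}` (certified rows) and `…CyclotomicLayerRoadBinary` (the certificate-free costs `λ₂ ≥ 2ⁿ + 3`, `≥ 2^{n₁} + 2^{n₂} + 3`).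

* §1 `λ₂ = 5` (1259 in g34's numerics; `ord₋₂ ∈ {1, 3}` both allowed): ★★ `mordellWeilRank_layer_succ_eq_of_negRoad_of_lam_five` (**`n ≥ 2 ⇒ rank W(ℚ_{n+1}) = rank W(ℚ_n)`**);
  ★★ `mordellWeilRank_layer_two_eq_or_of_negRoad_of_lam_five` (**`rank W(ℚ₂) = rank W(ℚ₁)` OR `= rank W(ℚ₁) + 2`** — for `ord₋₂ = 1` the double layer-`2` zero `Ψ₁² ∣ L₀` would leave
  a cofactor with `λ = μ = 0` of weight one, impossible); ★★ `mordellWeilRank_layer_eq_or_of_negRoad_of_lam_five` (**profile `{r₁, r₁ + 2}` at every `m ≥ 1`**);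
  `mordellWeilRank_layer_le_three_of_negRoad_of_lam_five` (**`+ hGZK`, `ord₋₂ = 1`: `rank W(ℚ_m) ≤ 3` at every layer**, vs Greenberg's `≤ λ = 5`).
* §2 `λ₂ = 7` (3523, 4307): `mordellWeilRank_layer_succ_eq_of_negRoad_of_lam_seven` (**`n ≥ 3 ⇒` stationary**), `mordellWeilRank_layer_two_eq_or_three_eq_of_negRoad_of_lam_seven`
  (**not both `ℚ₂/ℚ₁` and `ℚ₃/ℚ₂` grow**). (With the `ι`-pair certificate, `…RoadMinusPairs` pins the layer: only `ℚ₃/ℚ₂`, by exactly `4`.)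

References: K. Kato, Astérisque 295 (2004), Thm. 17.4 [Kato2004Asterisque]; R. Greenberg, LNM 1716 (1999), Thm. 1.9 (p. 63), §5 pp. 132, 176–177, 181 [GreenbergLNM1716];
L. Washington, GTM 83, §7.1, §13.2 [Washington1997].
-/

set_option linter.dupNamespace false
set_option autoImplicit false

noncomputable section

open scoped Classical MatrixGroups ModularForm Polynomial

namespace Summit.BirchSwinnertonDyer.BirchSwinnertonDyer.Theorems.AlignedTransportAtTwoCyclotomicLayerRoadMinusFive

open Polynomial CongruenceSubgroup WeierstrassCurve Literature.NumberTheory.EllipticCurves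
  Literature.NumberTheory.EllipticCurves.ModularForms
  Literature.NumberTheory.EllipticCurves.Rank1Residual
  Literature.NumberTheory.EllipticCurves.Rank1Residual.Typed
  Literature.NumberTheory.EllipticCurves.Greenberg1999
  Summit.BirchSwinnertonDyer.Rank1Residual
  Summit.BirchSwinnertonDyer.Rank1Residual.X1.MuLambda
  Summit.BirchSwinnertonDyer.Rank1Residual.X1.ParitySqueeze
  Summit.BirchSwinnertonDyer.Rank1Residual.Iwasawa
  Summit.BirchSwinnertonDyer.Rank1Residual.F1Sign2
  Summit.BirchSwinnertonDyer.BirchSwinnertonDyer.Theorems.AlignedTransportAtTwoSeed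
  Summit.BirchSwinnertonDyer.BirchSwinnertonDyer.Theorems.AlignedTransportAtTwoTwoFixedPoints
  Summit.BirchSwinnertonDyer.BirchSwinnertonDyer.Theorems.AlignedTransportAtTwoRoadSecondFixedPoint
  Summit.BirchSwinnertonDyer.BirchSwinnertonDyer.Theorems.AlignedTransportAtTwoEisensteinRigidity
  Summit.BirchSwinnertonDyer.BirchSwinnertonDyer.Theorems.AlignedTransportAtTwoEisensteinRigidityConservation
  Summit.BirchSwinnertonDyer.BirchSwinnertonDyer.Theorems.AlignedTransportAtTwoEisensteinRigidityPrime
  Summit.BirchSwinnertonDyer.BirchSwinnertonDyer.Theorems.AlignedTransportAtTwoLayerOneRankBound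
  Summit.BirchSwinnertonDyer.BirchSwinnertonDyer.Theorems.AlignedTransportAtTwoCyclotomicLayerPrime
  Summit.BirchSwinnertonDyer.BirchSwinnertonDyer.Theorems.AlignedTransportAtTwoCyclotomicLayerRankDichotomy
  Summit.BirchSwinnertonDyer.BirchSwinnertonDyer.Theorems.AlignedTransportAtTwoCyclotomicLayerLFunction
  Summit.BirchSwinnertonDyer.BirchSwinnertonDyer.Theorems.AlignedTransportAtTwoCyclotomicLayerRankJumpExact
  Summit.BirchSwinnertonDyer.BirchSwinnertonDyer.Theorems.AlignedTransportAtTwoCyclotomicLayerWeight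
  Summit.BirchSwinnertonDyer.BirchSwinnertonDyer.Theorems.AlignedTransportAtTwoCyclotomicLayerRoadMinus
  Summit.BirchSwinnertonDyer.BirchSwinnertonDyer.Theorems.AlignedTransportAtTwoCyclotomicLayerRoadBinary
  Summit.BirchSwinnertonDyer.BirchSwinnertonDyer.Theorems.DefectPrime

/-- (pure `Λ`-algebra, `p = 2`) **`Ψ_n² ∣ H₀`, `λ(H₀) = 2^{n+1}`, `μ(H₀) = 0 ⇒ ‖H₀(0)‖₂ = ¼`**: the cofactor of `Ψ_n²` has `λ = μ = 0`, hence is a unit, so `H₀ ~ Ψ_n²` has weight two.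
[cite: Washington1997, §7.1 and §13.2] -/
theorem norm_constantCoeff_eq_quarter_of_cyclotomicLayer_sq_dvd {H₀ : PowerSeries ℤ_[2]} {n : ℕ}
    (hH0 : H₀ ≠ 0) (h : (((cyclotomic (2 ^ (n + 1)) ℤ_[2]).comp (X + 1) : ℤ_[2][X]) : PowerSeries ℤ_[2]) ^ 2 ∣ H₀) (hlam : lam H₀ = 2 ^ (n + 1))
    (hμ : mu H₀ = 0) : ‖PowerSeries.constantCoeff H₀‖ = (2 : ℝ)⁻¹ ^ 2 := by
  obtain ⟨R, hR⟩ := h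
  have hΨ := prime_coe_cyclotomic_comp 2 n
  have hΨ2 : (((cyclotomic (2 ^ (n + 1)) ℤ_[2]).comp (X + 1) : ℤ_[2][X]) : PowerSeries ℤ_[2]) ^ 2 ≠ 0 := pow_ne_zero _ hΨ.ne_zero
  have hR0 : R ≠ 0 := by rintro rfl; exact hH0 (by rw [hR, mul_zero])
  have hlamΨ2 : lam ((((cyclotomic (2 ^ (n + 1)) ℤ_[2]).comp (X + 1) : ℤ_[2][X]) : PowerSeries ℤ_[2]) ^ 2) = 2 ^ (n + 1) := by
    rw [pow_two, lam_mul hΨ.ne_zero hΨ.ne_zero, lam_cyclotomicLayer_two]; ring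
  have hμΨ2 : mu ((((cyclotomic (2 ^ (n + 1)) ℤ_[2]).comp (X + 1) : ℤ_[2][X]) : PowerSeries ℤ_[2]) ^ 2) = 0 := by
    rw [pow_two, mu_mul hΨ.ne_zero hΨ.ne_zero, (mu_coe_cyclotomic_comp 2 n).1]
  have hlamR : lam R = 0 := by
    have h1 := lam_mul hΨ2 hR0
    rw [← hR, hlam, hlamΨ2] at h1
    omega
  have hμR : mu R = 0 := by
    have h1 := mu_mul hΨ2 hR0
    rw [← hR, hμ, hμΨ2] at h1
    omega
  have hRu : IsUnit R := (isUnit_iff_mu_eq_zero_and_lam_eq_zero R).mpr ⟨hR0, hμR, hlamR⟩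
  have hR1 : ‖PowerSeries.constantCoeff R‖ = 1 := PadicInt.isUnit_iff.mp (PowerSeries.isUnit_iff_constantCoeff.mp hRu)
  rw [hR, map_mul, norm_mul, hR1, mul_one, map_pow, norm_pow, norm_constantCoeff_cyclotomicLayer]
  norm_num

variable (W : WeierstrassCurve ℚ) [W.IsElliptic] [W.IsGloballyMinimal]

/-! ## §1 The `λ₂ = 5` row of the `a₂ = −1` road -/

/-- ★★ **`λ₂ = 5`, `a₂ = −1` road: NO Mordell–Weil growth above `ℚ₂` — `rank W(ℚ_{n+1}) = rank W(ℚ_n)` for every `n ≥ 2`.** `W/ℚ` globally minimal, good ordinary at `2`, `a₂ = −1`, `∏ c_v`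
odd, `Δ_min ≡ 3,5 (8)`, `r_an = 0`, `f` its newform at level `N_W` with `‖[0]⁺_f‖₂ = 1`, `G` an integral lift with `μ(G) = 0`, `λ(G) = 5`; PRINT `h17`. If `ord₋₂ = 1`, growth at `n+1`
costs `λ₂ ≥ 2ⁿ + 3` (binary file), so `n ≤ 1`; if `ord₋₂ = 3`, a jump forces `λ₂ = 2ⁿ + 3`, so `n = 1`. [cite: Kato2004Asterisque, Thm. 17.4 (1)(2) (p. 273)] [cite: GreenbergLNM1716, §5 pp. 177 and 181] -/
theorem mordellWeilRank_layer_succ_eq_of_negRoad_of_lam_five [NeZero (W.conductorNorm ℤ)] {f : CuspForm (Gamma0 (W.conductorNorm ℤ)) 2}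
    (h17 : kato_divisibility_allPrimes W 2 (f := f)) (hord : IsOrdinaryAt W 2) (hf : IsNewformOf W f) (hr : W.analyticRank = 0)
    (ha : W.frobeniusTrace 2 = -1) (hodd : Odd W.tamagawaProduct) (hΔ : minimalDiscriminantInt W % 8 = 3 ∨ minimalDiscriminantInt W % 8 = 5)
    {G : IwasawaAlgebra 2} (hG : iwasawaToPowerSeries 2 G = padicLFunction f (unitRoot W 2 : ℚ_[2])) (hμ : mu G = 0) (hlam : lam G = 5)
    (hsym : ‖(ratPlusSymbol f 0 : ℚ_[2])‖ = 1)
    {κ : ZpExtension ℚ 2} {γ : Field.absoluteGaloisGroup ℚ} (hκ : κ.IsCyclotomic) (hγ : κ.IsTopGenerator γ)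
    (hγ' : IsCyclotomicVariable 2 γ) {n : ℕ} (hn : 2 ≤ n) :
    (W.baseChange (κ.layer (n + 1))).mordellWeilRank = (W.baseChange (κ.layer n)).mordellWeilRank := by
  have hG0 : G ≠ 0 := by
    intro h0
    rw [h0, map_zero] at hG
    exact padicLFunction_unitRoot_ne_zero hord hf hG.symm
  obtain ⟨k, hk⟩ := exists_hasOrderAtNegTwo hG0
  have hk13 := orderAtNegTwo_eq_one_or_three_of_road_of_frobeniusTrace_eq_neg_one hord hf ha hodd hΔ hr hG hsym hk
  have h4 : 4 ≤ 2 ^ n := by simpa using Nat.pow_le_pow_right two_pos hn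
  by_contra hne
  have hlt : (W.baseChange (κ.layer n)).mordellWeilRank < (W.baseChange (κ.layer (n + 1))).mordellWeilRank :=
    lt_of_le_of_ne (mordellWeilRank_layer_le_succ W κ n) (Ne.symm hne)
  rcases hk13 with rfl | rfl
  · have h := lam_ge_two_pow_add_three_of_negRoad_of_growth W h17 hord hf ha hodd hΔ hG hμ hk hsym hκ hγ hγ' (by omega) hlt
    omega
  · rcases mordellWeilRank_layer_succ_eq_or_of_negRoad_ord_three W h17 hord hf ha hG hk hsym hκ hγ hγ' (n := n) (by omega) with h | ⟨-, h⟩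
    · exact hne h
    · omega

/-- ★★ **`λ₂ = 5`, `a₂ = −1` road: in the layer `ℚ₂/ℚ₁` the rank is stationary OR jumps by EXACTLY `2`** (same hypotheses). The exact jump is `2c` with `Ψ₁^c ∣ L₀` (g36); `c ≥ 2` is
impossible: for `ord₋₂ = 3` by degree (`3 + 4 > 5`), for `ord₋₂ = 1` because `L₀ = (T+2)·Ψ₁²·R` would have `λ(R) = μ(R) = 0`, `R` a unit, and weight `1 + 2 + 0 ≠ 4`.
[cite: Kato2004Asterisque, Thm. 17.4 (1)(2) (p. 273) and Thm. 18.4 (p. 281)] [cite: GreenbergLNM1716, §5 pp. 177 and 181] -/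
theorem mordellWeilRank_layer_two_eq_or_of_negRoad_of_lam_five [NeZero (W.conductorNorm ℤ)] {f : CuspForm (Gamma0 (W.conductorNorm ℤ)) 2}
    (h17 : kato_divisibility_allPrimes W 2 (f := f)) (hord : IsOrdinaryAt W 2) (hf : IsNewformOf W f) (hr : W.analyticRank = 0)
    (ha : W.frobeniusTrace 2 = -1) (hodd : Odd W.tamagawaProduct) (hΔ : minimalDiscriminantInt W % 8 = 3 ∨ minimalDiscriminantInt W % 8 = 5)
    {G : IwasawaAlgebra 2} (hG : iwasawaToPowerSeries 2 G = padicLFunction f (unitRoot W 2 : ℚ_[2])) (hμ : mu G = 0) (hlam : lam G = 5)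
    (hsym : ‖(ratPlusSymbol f 0 : ℚ_[2])‖ = 1)
    {κ : ZpExtension ℚ 2} {γ : Field.absoluteGaloisGroup ℚ} (hκ : κ.IsCyclotomic) (hγ : κ.IsTopGenerator γ)
    (hγ' : IsCyclotomicVariable 2 γ) :
    (W.baseChange (κ.layer 2)).mordellWeilRank = (W.baseChange (κ.layer 1)).mordellWeilRank ∨
      (W.baseChange (κ.layer 2)).mordellWeilRank = (W.baseChange (κ.layer 1)).mordellWeilRank + 2 := by
  have hX : Prime (PowerSeries.X + PowerSeries.C (2 : ℤ_[2]) : PowerSeries ℤ_[2]) := prime_X_add_C_two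
  have hG0 : G ≠ 0 := by
    intro h0
    rw [h0, map_zero] at hG
    exact padicLFunction_unitRoot_ne_zero hord hf hG.symm
  obtain ⟨k, hk⟩ := exists_hasOrderAtNegTwo hG0
  have hk13 := orderAtNegTwo_eq_one_or_three_of_road_of_frobeniusTrace_eq_neg_one hord hf ha hodd hΔ hr hG hsym hk
  rcases hk13 with rfl | rfl
  · -- `ord₋₂ = 1`: the exact jump `2c`, and `c ≤ 1` by the weight of the cofactor
    obtain ⟨c, hdvd, hc⟩ := exists_cyclotomicLayer_pow_dvd_lift_and_mordellWeilRank_eq W h17 hord hf hG hκ hγ hγ' 1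
    have hc' : (W.baseChange (κ.layer (1 + 1))).mordellWeilRank = (W.baseChange (κ.layer 1)).mordellWeilRank + 2 ^ 1 * (2 - 1) * c := hc
    have hw : ‖PowerSeries.constantCoeff G‖ = (2 : ℝ)⁻¹ ^ (3 + 1) := norm_constantCoeff_lift_of_frobeniusTrace_eq_neg_one W hord hf ha hG hsym
    obtain ⟨H₀, hGH⟩ := hk.1
    obtain ⟨-, hH₀w⟩ := norm_constantCoeff_cofactor_eq hGH hw
    have hH00 : H₀ ≠ 0 := by rintro h0; exact hG0 (by rw [hGH, h0, mul_zero])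
    have hlamH : lam H₀ = 2 ^ (1 + 1) := by
      have h1 := lam_mul (pow_ne_zero 1 hX.ne_zero) hH00
      rw [← hGH, hlam, lam_X_add_C_two_pow] at h1
      omega
    have hμH : mu H₀ = 0 := by
      have h1 := mu_mul (pow_ne_zero 1 hX.ne_zero) hH00
      rw [← hGH, hμ, pow_one, mu_X_add_C_two_and_pfree.1] at h1
      omega
    have hc1 : c ≤ 1 := by
      by_contra hlt
      have h2 : (((cyclotomic (2 ^ (1 + 1)) ℤ_[2]).comp (X + 1) : ℤ_[2][X]) : PowerSeries ℤ_[2]) ^ 2 ∣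
          (PowerSeries.X + PowerSeries.C (2 : ℤ_[2])) ^ 1 * H₀ := by
        rw [← hGH]; exact dvd_trans (pow_dvd_pow _ (by omega)) hdvd
      have h3 := (prime_coe_cyclotomic_comp 2 1).pow_dvd_of_dvd_mul_left 2 (not_cyclotomicLayer_dvd_X_add_C_two_pow le_rfl 1) h2
      have h4 := norm_constantCoeff_eq_quarter_of_cyclotomicLayer_sq_dvd hH00 h3 hlamH hμH
      rw [hH₀w] at h4
      norm_num at h4
    have h2 : (W.baseChange (κ.layer 2)).mordellWeilRank = (W.baseChange (κ.layer 1)).mordellWeilRank + 2 * c := by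
      simpa using hc'
    rcases Nat.le_one_iff_eq_zero_or_eq_one.mp hc1 with rfl | rfl
    · left; omega
    · right; omega
  · -- `ord₋₂ = 3`: the certified-by-itself row of `…RoadMinus`
    rcases mordellWeilRank_layer_succ_eq_or_of_negRoad_ord_three W h17 hord hf ha hG hk hsym hκ hγ hγ' (n := 1) le_rfl with h | ⟨h, -⟩
    · exact Or.inl h
    · exact Or.inr (by simpa using h)

/-- ★★ **THE PROFILE OF THE `λ₂ = 5` ROW (`a₂ = −1`): `rank W(ℚ_m) = rank W(ℚ₁)` OR `rank W(ℚ_m) = rank W(ℚ₁) + 2`, for every `m ≥ 1`** — certificate-free (`ord₋₂ ∈ {1,3}` both covered);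
the only layer that can grow above `ℚ(√2)` is `ℚ₂ = ℚ(ζ₁₆)⁺`, by exactly `2`. [cite: Kato2004Asterisque, Thm. 17.4 (1)(2) (p. 273)] [cite: GreenbergLNM1716, Thm. 1.9 (p. 63) and §5 p. 177] -/
theorem mordellWeilRank_layer_eq_or_of_negRoad_of_lam_five [NeZero (W.conductorNorm ℤ)] {f : CuspForm (Gamma0 (W.conductorNorm ℤ)) 2}
    (h17 : kato_divisibility_allPrimes W 2 (f := f)) (hord : IsOrdinaryAt W 2) (hf : IsNewformOf W f) (hr : W.analyticRank = 0)
    (ha : W.frobeniusTrace 2 = -1) (hodd : Odd W.tamagawaProduct) (hΔ : minimalDiscriminantInt W % 8 = 3 ∨ minimalDiscriminantInt W % 8 = 5)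
    {G : IwasawaAlgebra 2} (hG : iwasawaToPowerSeries 2 G = padicLFunction f (unitRoot W 2 : ℚ_[2])) (hμ : mu G = 0) (hlam : lam G = 5)
    (hsym : ‖(ratPlusSymbol f 0 : ℚ_[2])‖ = 1)
    {κ : ZpExtension ℚ 2} {γ : Field.absoluteGaloisGroup ℚ} (hκ : κ.IsCyclotomic) (hγ : κ.IsTopGenerator γ)
    (hγ' : IsCyclotomicVariable 2 γ) {m : ℕ} (hm : 1 ≤ m) :
    (W.baseChange (κ.layer m)).mordellWeilRank = (W.baseChange (κ.layer 1)).mordellWeilRank ∨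
      (W.baseChange (κ.layer m)).mordellWeilRank = (W.baseChange (κ.layer 1)).mordellWeilRank + 2 := by
  induction m, hm using Nat.le_induction with
  | base => exact Or.inl rfl
  | succ m hm ih =>
    rcases Nat.lt_or_ge m 2 with hm2 | hm2
    · have hm1 : m = 1 := by omega
      subst hm1
      exact mordellWeilRank_layer_two_eq_or_of_negRoad_of_lam_five W h17 hord hf hr ha hodd hΔ hG hμ hlam hsym hκ hγ hγ'
    · rw [mordellWeilRank_layer_succ_eq_of_negRoad_of_lam_five W h17 hord hf hr ha hodd hΔ hG hμ hlam hsym hκ hγ hγ' hm2]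
      exact ih

/-- ★ **`+ hGZK`, `ord₋₂ = 1`: on the `λ₂ = 5` row of the `a₂ = −1` road `rank W(ℚ_m) ≤ 3` at EVERY layer** (`rank W(ℚ) = 0`, `rank W(ℚ₁) ≤ 1`, at most one jump of `2`) — vs the
general bound `rank ≤ λ = 5` (Greenberg Thm. 1.9 / Kato). [cite: Kato2004Asterisque, Thm. 17.4 (1)(2) (p. 273)] [cite: GreenbergLNM1716, Thm. 1.9 (p. 63) and §5 p. 181] -/
theorem mordellWeilRank_layer_le_three_of_negRoad_of_lam_five [NeZero (W.conductorNorm ℤ)] {f : CuspForm (Gamma0 (W.conductorNorm ℤ)) 2}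
    (h17 : kato_divisibility_allPrimes W 2 (f := f)) (hGZK : rank_eq_analyticRank_of_analyticRank_le_one)
    (hord : IsOrdinaryAt W 2) (hf : IsNewformOf W f) (hr : W.analyticRank = 0)
    (ha : W.frobeniusTrace 2 = -1) (hodd : Odd W.tamagawaProduct) (hΔ : minimalDiscriminantInt W % 8 = 3 ∨ minimalDiscriminantInt W % 8 = 5)
    {G : IwasawaAlgebra 2} (hG : iwasawaToPowerSeries 2 G = padicLFunction f (unitRoot W 2 : ℚ_[2])) (hμ : mu G = 0) (hlam : lam G = 5)
    (h1 : HasOrderAtNegTwo G 1) (hsym : ‖(ratPlusSymbol f 0 : ℚ_[2])‖ = 1)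
    {κ : ZpExtension ℚ 2} {γ : Field.absoluteGaloisGroup ℚ} (hκ : κ.IsCyclotomic) (hγ : κ.IsTopGenerator γ)
    (hγ' : IsCyclotomicVariable 2 γ) (m : ℕ) : (W.baseChange (κ.layer m)).mordellWeilRank ≤ 3 := by
  have hrk : W.mordellWeilRank = 0 := by rw [(hGZK W (by rw [hr]; exact zero_le_one)).1, hr]
  have hle1 : (W.baseChange (κ.layer 1)).mordellWeilRank ≤ W.mordellWeilRank + 1 :=
    mordellWeilRank_layer_one_le_add_orderAtNegTwo W h17 hord hf hG h1 hκ hγ hγ'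
  rcases Nat.eq_zero_or_pos m with rfl | hm
  · have h01 : (W.baseChange (κ.layer 0)).mordellWeilRank ≤ (W.baseChange (κ.layer (0 + 1))).mordellWeilRank :=
      mordellWeilRank_layer_le_succ W κ 0
    have h01' : (W.baseChange (κ.layer 0)).mordellWeilRank ≤ (W.baseChange (κ.layer 1)).mordellWeilRank := h01
    omega
  · rcases mordellWeilRank_layer_eq_or_of_negRoad_of_lam_five W h17 hord hf hr ha hodd hΔ hG hμ hlam hsym hκ hγ hγ' hm with h | h <;> omega

/-! ## §2 The `λ₂ = 7` row of the `a₂ = −1` road -/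

/-- **`λ₂ = 7`, `a₂ = −1` road: no growth above `ℚ₃` — `rank W(ℚ_{n+1}) = rank W(ℚ_n)` for every `n ≥ 3`** (hypotheses as in §1 with `λ(G) = 7`): `ord₋₂ = 1` costs `2ⁿ + 3 ≤ 7`,
`ord₋₂ = 3` forces `2ⁿ + 3 = 7`; either way `n ≤ 2`. [cite: Kato2004Asterisque, Thm. 17.4 (1)(2) (p. 273)] [cite: GreenbergLNM1716, §5 pp. 177 and 181] -/
theorem mordellWeilRank_layer_succ_eq_of_negRoad_of_lam_seven [NeZero (W.conductorNorm ℤ)] {f : CuspForm (Gamma0 (W.conductorNorm ℤ)) 2}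
    (h17 : kato_divisibility_allPrimes W 2 (f := f)) (hord : IsOrdinaryAt W 2) (hf : IsNewformOf W f) (hr : W.analyticRank = 0)
    (ha : W.frobeniusTrace 2 = -1) (hodd : Odd W.tamagawaProduct) (hΔ : minimalDiscriminantInt W % 8 = 3 ∨ minimalDiscriminantInt W % 8 = 5)
    {G : IwasawaAlgebra 2} (hG : iwasawaToPowerSeries 2 G = padicLFunction f (unitRoot W 2 : ℚ_[2])) (hμ : mu G = 0) (hlam : lam G = 7)
    (hsym : ‖(ratPlusSymbol f 0 : ℚ_[2])‖ = 1)
    {κ : ZpExtension ℚ 2} {γ : Field.absoluteGaloisGroup ℚ} (hκ : κ.IsCyclotomic) (hγ : κ.IsTopGenerator γ)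
    (hγ' : IsCyclotomicVariable 2 γ) {n : ℕ} (hn : 3 ≤ n) :
    (W.baseChange (κ.layer (n + 1))).mordellWeilRank = (W.baseChange (κ.layer n)).mordellWeilRank := by
  have hG0 : G ≠ 0 := by
    intro h0
    rw [h0, map_zero] at hG
    exact padicLFunction_unitRoot_ne_zero hord hf hG.symm
  obtain ⟨k, hk⟩ := exists_hasOrderAtNegTwo hG0
  have hk13 := orderAtNegTwo_eq_one_or_three_of_road_of_frobeniusTrace_eq_neg_one hord hf ha hodd hΔ hr hG hsym hk
  have h8 : 8 ≤ 2 ^ n := by simpa using Nat.pow_le_pow_right two_pos hn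
  by_contra hne
  have hlt : (W.baseChange (κ.layer n)).mordellWeilRank < (W.baseChange (κ.layer (n + 1))).mordellWeilRank :=
    lt_of_le_of_ne (mordellWeilRank_layer_le_succ W κ n) (Ne.symm hne)
  rcases hk13 with rfl | rfl
  · have h := lam_ge_two_pow_add_three_of_negRoad_of_growth W h17 hord hf ha hodd hΔ hG hμ hk hsym hκ hγ hγ' (by omega) hlt
    omega
  · rcases mordellWeilRank_layer_succ_eq_or_of_negRoad_ord_three W h17 hord hf ha hG hk hsym hκ hγ hγ' (n := n) (by omega) with h | ⟨-, h⟩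
    · exact hne h
    · omega

/-- **`λ₂ = 7`, `a₂ = −1` road: the layers `ℚ₂/ℚ₁` and `ℚ₃/ℚ₂` do not BOTH grow** (hypotheses as above): for `ord₋₂ = 1` two growth layers cost `λ₂ ≥ 2 + 4 + 3 = 9`; for `ord₋₂ = 3`
the single admissible jump is in `ℚ₃/ℚ₂` (`2ⁿ = 4`). [cite: Kato2004Asterisque, Thm. 17.4 (1)(2) (p. 273)] [cite: GreenbergLNM1716, §5 pp. 177 and 181] -/
theorem mordellWeilRank_layer_two_eq_or_three_eq_of_negRoad_of_lam_seven [NeZero (W.conductorNorm ℤ)] {f : CuspForm (Gamma0 (W.conductorNorm ℤ)) 2}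
    (h17 : kato_divisibility_allPrimes W 2 (f := f)) (hord : IsOrdinaryAt W 2) (hf : IsNewformOf W f) (hr : W.analyticRank = 0)
    (ha : W.frobeniusTrace 2 = -1) (hodd : Odd W.tamagawaProduct) (hΔ : minimalDiscriminantInt W % 8 = 3 ∨ minimalDiscriminantInt W % 8 = 5)
    {G : IwasawaAlgebra 2} (hG : iwasawaToPowerSeries 2 G = padicLFunction f (unitRoot W 2 : ℚ_[2])) (hμ : mu G = 0) (hlam : lam G = 7)
    (hsym : ‖(ratPlusSymbol f 0 : ℚ_[2])‖ = 1)
    {κ : ZpExtension ℚ 2} {γ : Field.absoluteGaloisGroup ℚ} (hκ : κ.IsCyclotomic) (hγ : κ.IsTopGenerator γ)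
    (hγ' : IsCyclotomicVariable 2 γ) :
    (W.baseChange (κ.layer 2)).mordellWeilRank = (W.baseChange (κ.layer 1)).mordellWeilRank ∨
      (W.baseChange (κ.layer 3)).mordellWeilRank = (W.baseChange (κ.layer 2)).mordellWeilRank := by
  have hG0 : G ≠ 0 := by
    intro h0
    rw [h0, map_zero] at hG
    exact padicLFunction_unitRoot_ne_zero hord hf hG.symm
  obtain ⟨k, hk⟩ := exists_hasOrderAtNegTwo hG0
  have hk13 := orderAtNegTwo_eq_one_or_three_of_road_of_frobeniusTrace_eq_neg_one hord hf ha hodd hΔ hr hG hsym hk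
  by_cases h12 : (W.baseChange (κ.layer 2)).mordellWeilRank = (W.baseChange (κ.layer 1)).mordellWeilRank
  · exact Or.inl h12
  by_cases h23 : (W.baseChange (κ.layer 3)).mordellWeilRank = (W.baseChange (κ.layer 2)).mordellWeilRank
  · exact Or.inr h23
  exfalso
  have hlt1 : (W.baseChange (κ.layer 1)).mordellWeilRank < (W.baseChange (κ.layer (1 + 1))).mordellWeilRank :=
    lt_of_le_of_ne (mordellWeilRank_layer_le_succ W κ 1) (Ne.symm h12)
  have hlt2 : (W.baseChange (κ.layer 2)).mordellWeilRank < (W.baseChange (κ.layer (2 + 1))).mordellWeilRank :=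
    lt_of_le_of_ne (mordellWeilRank_layer_le_succ W κ 2) (Ne.symm h23)
  rcases hk13 with rfl | rfl
  · have h := lam_ge_of_two_growthLayers_of_negRoad W h17 hord hf ha hodd hΔ hG hμ hk hsym hκ hγ hγ' (n₁ := 1) (n₂ := 2) le_rfl one_lt_two hlt1 hlt2
    omega
  · rcases mordellWeilRank_layer_succ_eq_or_of_negRoad_ord_three W h17 hord hf ha hG hk hsym hκ hγ hγ' (n := 1) le_rfl with h | ⟨-, h⟩
    · exact h12 h
    · omega

end Summit.BirchSwinnertonDyer.BirchSwinnertonDyer.Theorems.AlignedTransportAtTwoCyclotomicLayerRoadMinusFive
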